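import Mathlib
import Summits.CriticalPhenomena.CardyFormulaZ2.Theses.CardyMagicRigidity
import Summits.CriticalPhenomena.CardyFormulaZ2.Theorems.CardyMagicRigidityDefs
import Summits.CriticalPhenomena.CardyFormulaZ2.Theorems.CardyMagicRigidityNestingRigidityCloudAdmissibility
import Summits.CriticalPhenomena.CardyFormulaZ2.Theorems.CardyMagicRigidityNestingRigidityCloudEnergy
import Literature.Probability.RandomPlanarGeometry.NestingTransform
import Literature.Probability.Percolation.FullPlaneCNL
import Literature.Barriers.CriticalPhenomena.NestingTransformBlindness

/-!
# Line `ring-cloud-tomography` — skeleton for crux `NestingRigidity` (stmt-CriticalPhenomena-4835)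

Route `CardyMagicRigidity` (sub-problem `CriticalPhenomena/CardyFormulaZ2`). The crux, by name:
`Summit.CriticalPhenomena.CardyFormulaZ2.Theses.CardyMagicRigidity.NestingRigidity ≡
MagicFormulaZ2 → MagicFormulaT → LoopLimitZ2EqT` (the bond-`ℤ²` and site-`𝕋` `cos_μ`-nesting
transforms are both Gaussian ⇒ the two full-plane loop ensembles merge in DKKMO's `d_CN`).

THE LINE (card `Ideas/ring-cloud-tomography.md`, triage `TRIAGE-r1-{1,2,3}.md`). Test functions
= CLOUDS: finitely many disc bumps and ring (annulus) charges. A ring has constant logarithmic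
potential in its hole (mean-value property), so the Gaussian side of every cloud identity is an
explicit product of pure powers — one exponential per scale band (`CloudCalculus`, stub S1, provable
now). On the loop side a ring cloud writes an arbitrary positive weight profile `u_k = w(Λ_k)`,
`w(θ) = 2cos(θ + π/3)`, onto the tower of loops nested around a point; in the fully positive regime
(total positive charge `≤ π/6`, triage F1/F7) this reads the tower PRESSURE `e(u)` exactly on
`u ∈ [0, √3]` up to ONE constant, the background charge `a = √3 ×` nesting density (S2); `a = 1/2π`
is the quantisation step (S3, shared with cards `pressure-branch-point` / `positive-cone-weight-
doubling`); exact single-exponential identities for every band width make the electrically probed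
tower rank one, and — HERE non-crossing enters — the lattice interface-Markov property makes the
loops around a point a single Markov renewal tower (the barrier's `CLE₃ ⊔ CLE₃` impostor is a
superposition of two towers and has no such structure), so pressure + rank one pin the decrement
law by Laplace uniqueness and the one-point count laws of `ℤ²` and `𝕋` agree (S4, hardest); fusion
ratios / the `η`-squeeze / multivariable Laplace uniqueness lift this to all finite disc-pattern
count laws (S5); equal pattern statistics plus tightness, covering degree one and the lattice type
symmetries give `d_CN → 0` (S6, magic-free lattice topology).

Layout (lead reshape r2, 2026-08-16).  §0–§1 (vocabulary and the stub STATEMENTS) now live in the landed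
definitions module `Theorems/CardyMagicRigidityDefs.lean` (p71837), imported here; S1a `stub_cloudAdmissibility`
(p72339) and S1b `stub_cloudEnergy` (p74556) are LANDED and imported (no sorry); S4b `stub_tiltUniqueness` is LANDED (p75974) but kept
as a local sorried copy in THIS revision only because the farm had not rebuilt its module at registration time.  §2 sorry-free glue ·
§3 the registered stubs still open (the ONLY sorries): S2 `stub_towerPressureFamily`, S3
`stub_chargeQuantisation`, S4a `stub_towerTilt` (S4 reshaped into S4a `stub_towerTilt` (cloud laws + pressures ⇒ the positively
TILTED one-point tower moments `E[∏ⱼ uⱼ^{N_x(ρⱼ,R)}]`, `u ∈ (0,1)^m`, of the two lattices merge — the research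
content, held by the lead) and S4b `stub_tiltUniqueness` (tilted moments ⇒ count laws: multivariate PGF
identity theorem in limit form — LANDED p75974; `towerLaw_of` recombines them into `TowerLaw`)), S5 `stub_fusion`,
S6 `stub_transfer` · §4 the composition `nestingRigidity_of_stubs` (sorry-free) and
`NestingRigidity_of : NestingRigidity` (concludes the crux BY NAME; closed once the six `stub_*` are).
Landed helpers of this line so far (all `--supports stmt-CriticalPhenomena-4835`): Defs p71837, CloudAdmissibility
p72339, ShellPotential p72878, PairEnergies p73436, CloudEnergy p74556, TowerPressureSanity p72271,
TowerCountMeasurable p72444, ChargeQuantisationReduction p72422, FusionBaseCases p72284, TransferGluing p72412, TiltUniqueness p75974;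
refuter's Negative/PressureFamilyConstraints p74509.
-/

noncomputable section

open MeasureTheory Set Filter Metric
open scoped Real Topology BigOperators

namespace Summit.CriticalPhenomena.CardyFormulaZ2.Cruxes.NestingRigidity.RingCloudTomography

open Literature.Probability.RandomPlanarGeometry Literature.Probability.Percolation
  Literature.Probability.LatticeModels
open _root_.Summit.CriticalPhenomena.CardyFormulaZ2.Theses.CardyMagicRigidity
  (MagicFormulaZ2 MagicFormulaT LoopLimitZ2EqT NestingRigidity)

/-! ## §0–§1 Vocabulary and stub statements: `Theorems/CardyMagicRigidityDefs.lean` (imported).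
S1a/S1b: `stub_cloudAdmissibility : CloudAdmissibility`, `stub_cloudEnergy : CloudEnergy` (imported, proved). -/

example : CloudAdmissibility := stub_cloudAdmissibility
example : CloudEnergy := stub_cloudEnergy
example : CloudCalculus := cloudCalculus_of stub_cloudAdmissibility stub_cloudEnergy

/-! ## §2 Glue (sorry-free) -/

/-- The route's `MagicFormulaZ2` IS the magic transform of `zEns` (the route functional is
`LoopConfig.nestingWeight`, `nestingWeight_eq_finprod`). -/
theorem hasMagicTransform_zEns (h : MagicFormulaZ2) : zEns.HasMagicTransform :=
  fun f R C hf hC hR h0 ↦ h f R C hf hC hR h0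

/-- Both types together of the site-`𝕋` configuration are the untyped interface loops over which
`MagicFormulaT` takes its product. -/
theorem loops_siteLoopConfig (δ : ℝ) (cfg : SiteConfig (Site 2)) :
    (siteLoopConfig δ cfg).loops =
      {u : UnbasedLoop ℂ | ∃ (v : HexVertex) (γ : hexGraph.Walk v v), IsSiteInterfaceLoop cfg γ ∧
        u = UnbasedLoop.mk (BasedLoop.mk (siteLoopCurve δ γ) (isLoop_siteLoopCurve δ γ))} := by
  ext u
  constructor
  · rintro (⟨v, γ, h, -, rfl⟩ | ⟨v, γ, h, -, rfl⟩) <;> exact ⟨v, γ, h, rfl⟩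
  · rintro ⟨v, γ, h, rfl⟩
    by_cases hs : 0 < shoelace (γ.support.map hexCenter)
    · exact Or.inr ⟨v, γ, h, ⟨fun _ ↦ hs, fun _ ↦ rfl⟩, rfl⟩
    · exact Or.inl ⟨v, γ, h, ⟨fun h0 ↦ absurd h0 (by decide), fun h' ↦ absurd h' hs⟩, rfl⟩

/-- The route's `MagicFormulaT` IS the magic transform of `tEns`. -/
theorem hasMagicTransform_tEns (h : MagicFormulaT) : tEns.HasMagicTransform := by
  intro f R C hf hC hR h0
  have key := h f R C hf hC hR h0
  have hfun : (fun δ : ℝ ↦ ∫ ω, (tEns.X δ ω).nestingWeight f ∂tEns.P) =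
      fun δ : ℝ ↦ ∫ cfg, (∏ᶠ u ∈ {u : UnbasedLoop ℂ | ∃ (v : HexVertex) (γ : hexGraph.Walk v v),
        IsSiteInterfaceLoop cfg γ ∧
          u = UnbasedLoop.mk (BasedLoop.mk (siteLoopCurve δ γ) (isLoop_siteLoopCurve δ γ))},
            2 * Real.cos ((∫ z in {z : ℂ | u.wind z ≠ 0}, f z) + Real.pi / 3))
              ∂(triSitePercolation half) := by
    funext δ
    show (∫ ω, (siteLoopConfig δ ω).nestingWeight f ∂(triSitePercolation half)) = _
    congr 1
    funext cfg
    rw [LoopConfig.nestingWeight, loops_siteLoopConfig]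
    rfl
  rw [hfun]
  exact key

/-- Cloud calculus + magic formula ⇒ cloud law (instantiate the magic formula at the cloud density
and substitute the explicit energy). -/
theorem cloudLaw_of_hasMagicTransform (h1 : CloudCalculus) {E : LoopEnsemble}
    (hE : E.HasMagicTransform) : E.CloudLaw := by
  intro 𝔠 h𝔠
  obtain ⟨hm, ⟨C, hC⟩, ⟨R, hR⟩, h0, hQ⟩ := h1 𝔠 h𝔠
  rw [← hQ]
  exact hE _ R C hm hC hR h0

/-- Awareness check against the landed negatives (barrier `NestingTransformBlindness`): the
transform-only identification principles it refutes are not among the stubs — S4–S6 are statements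
about the two LATTICE ensembles, whose non-crossing, covering-degree-one and type structure the proofs
use. -/
example : Literature.Barriers.CriticalPhenomena.NestingTransformBlindness :=
  Literature.Barriers.CriticalPhenomena.nestingTransformBlindness_holds

/-! ## §3 Registered stubs (the only sorries of the file) -/

theorem stub_towerPressureFamily : TowerPressureFamily := by
  sorry

theorem stub_chargeQuantisation : ChargeQuantisation := by
  sorry

/-- **S4a · TowerTilt** (lead; the research content of S4). Both cloud laws and both pressures
`= e₆` force the positively TILTED finite-dimensional one-point tower moments of the two lattices to
merge: for every centre `x`, radii `0 < ρⱼ < R` and weights `u ∈ (0,1)^m`,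
`E_ℤ²[∏ⱼ uⱼ^{N_x(ρⱼ,R)}] − E_𝕋[∏ⱼ uⱼ^{N_x(ρⱼ,R)}] → 0` as `δ → 0⁺`.  Intended mechanism (a)–(c),(e) of
S4: non-crossing chain + lattice interface-Markov tower + electric rank one from the exact
single-exponential ring identities; the weights `u ∈ (0,1)` are in the fully positive regime
`u = 2cos(Λ + π/3)`, `Λ ∈ (π/6 − arccos(u/2)…)`.  This is where "no dark modes" must be derived. -/
theorem stub_towerTilt :
    zEns.CloudLaw → tEns.CloudLaw →
      zEns.HasTowerPressure e6 (Icc 0 (Real.sqrt 3)) → tEns.HasTowerPressure e6 (Icc 0 (Real.sqrt 3)) →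
        ∀ (x : ℂ) (m : ℕ) (ρ : Fin m → ℝ) (R : ℝ) (u : Fin m → ℝ), (∀ j, 0 < ρ j) → (∀ j, ρ j < R) →
          (∀ j, 0 < u j ∧ u j < 1) →
            Tendsto (fun δ : ℝ ↦ (∫ ω, ∏ j, u j ^ towerCount (zEns.X δ ω) x (ρ j) R ∂zEns.P) -
              ∫ ω, ∏ j, u j ^ towerCount (tEns.X δ ω) x (ρ j) R ∂tEns.P) (𝓝[>] 0) (𝓝 0) := by
  sorry

/-- **S4b · TiltUniqueness** — LANDED as `Theorems/CardyMagicRigidityNestingRigidityTiltUniqueness.lean`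
(p75974, sorry-free).  This local sorried copy stands in ONLY because the Lean farm had not yet rebuilt
that module when this skeleton revision was registered (rc 75 "unbuilt"); the final skeleton
(`work/NestingRigidity-final.lean` in the lead's folder) imports the landed module instead and has no
sorry here.  Statement: asymptotic agreement of the tilted moments `E[∏ⱼ uⱼ^{Nⱼ}]` on the open box
`u ∈ (0,1)^m` forces asymptotic agreement of every cylinder probability of the count vector
(multivariate PGF identity theorem in limit form). -/
theorem stub_tiltUniqueness :
    (∀ (x : ℂ) (m : ℕ) (ρ : Fin m → ℝ) (R : ℝ) (u : Fin m → ℝ), (∀ j, 0 < ρ j) → (∀ j, ρ j < R) →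
      (∀ j, 0 < u j ∧ u j < 1) →
        Tendsto (fun δ : ℝ ↦ (∫ ω, ∏ j, u j ^ towerCount (zEns.X δ ω) x (ρ j) R ∂zEns.P) -
          ∫ ω, ∏ j, u j ^ towerCount (tEns.X δ ω) x (ρ j) R ∂tEns.P) (𝓝[>] 0) (𝓝 0)) →
      TowerStatisticsAgree := by
  sorry  -- LANDED p75974 (see docstring); import swap pending farm rebuild

theorem stub_fusion : Fusion := by
  sorry

theorem stub_transfer : Transfer := by
  sorry

/-- S4 recombined from its two registered halves: S4a gives the tilted moments, S4b turns them into
count laws. -/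
theorem towerLaw_of
    (h4a : zEns.CloudLaw → tEns.CloudLaw →
      zEns.HasTowerPressure e6 (Icc 0 (Real.sqrt 3)) → tEns.HasTowerPressure e6 (Icc 0 (Real.sqrt 3)) →
        ∀ (x : ℂ) (m : ℕ) (ρ : Fin m → ℝ) (R : ℝ) (u : Fin m → ℝ), (∀ j, 0 < ρ j) → (∀ j, ρ j < R) →
          (∀ j, 0 < u j ∧ u j < 1) →
            Tendsto (fun δ : ℝ ↦ (∫ ω, ∏ j, u j ^ towerCount (zEns.X δ ω) x (ρ j) R ∂zEns.P) -
              ∫ ω, ∏ j, u j ^ towerCount (tEns.X δ ω) x (ρ j) R ∂tEns.P) (𝓝[>] 0) (𝓝 0))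
    (h4b : (∀ (x : ℂ) (m : ℕ) (ρ : Fin m → ℝ) (R : ℝ) (u : Fin m → ℝ), (∀ j, 0 < ρ j) → (∀ j, ρ j < R) →
      (∀ j, 0 < u j ∧ u j < 1) →
        Tendsto (fun δ : ℝ ↦ (∫ ω, ∏ j, u j ^ towerCount (zEns.X δ ω) x (ρ j) R ∂zEns.P) -
          ∫ ω, ∏ j, u j ^ towerCount (tEns.X δ ω) x (ρ j) R ∂tEns.P) (𝓝[>] 0) (𝓝 0)) →
      TowerStatisticsAgree) :
    TowerLaw :=
  fun cZ cT pZ pT ↦ h4b (h4a cZ cT pZ pT)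

/-! ## §4 The composition: S1 → ⋯ → S6 → crux -/

/-- Local alias of the crux `NestingRigidity` (so that `NestingRigidity_of` below is the ONLY theorem
of the file concluding the crux by name, as the skeleton audit requires). -/
def CruxStatement : Prop := NestingRigidity

/-- **The reduction, sorry-free**: cloud calculus (S1 = S1a ∧ S1b) turns both magic formulas into
cloud laws; ring tomography reads the tower pressure family (S2) and quantises the background charge
(S3) on BOTH lattices; pressures + rank one + interface-Markov give equal tilted tower moments (S4a),
PGF uniqueness equal one-point tower laws (S4b); fusion lifts to all nesting-tree statistics (S5);
transfer gives `d_CN → 0` (S6), i.e. `LoopLimitZ2EqT`.  `MagicFormulaT` is used (honouring "any proof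
must use the 𝕋 side": the typed crux is `MZ2 → MFT → X`, and `MZ2 → X` alone is universality with no
anchor). -/
theorem nestingRigidity_of_stubs (h1a : CloudAdmissibility) (h1b : CloudEnergy)
    (h2 : TowerPressureFamily) (h3 : ChargeQuantisation) (h4 : TowerLaw) (h5 : Fusion)
    (h6 : Transfer) : CruxStatement := by
  show NestingRigidity
  intro hZ hT
  have h1 : CloudCalculus := cloudCalculus_of h1a h1b
  have mZ : zEns.HasMagicTransform := hasMagicTransform_zEns hZ
  have mT : tEns.HasMagicTransform := hasMagicTransform_tEns hT
  have cZ : zEns.CloudLaw := cloudLaw_of_hasMagicTransform h1 mZ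
  have cT : tEns.CloudLaw := cloudLaw_of_hasMagicTransform h1 mT
  have pZ : zEns.HasTowerPressure e6 (Icc 0 (Real.sqrt 3)) := h3 zEns zEns_mem cZ (h2 zEns zEns_mem cZ)
  have pT : tEns.HasTowerPressure e6 (Icc 0 (Real.sqrt 3)) := h3 tEns tEns_mem cT (h2 tEns tEns_mem cT)
  have hX : LoopLimitZ2EqT := h6 (h5 cZ cT (h4 cZ cT pZ pT))
  exact hX

/-- **Ring-cloud tomography closes `NestingRigidity`** — the skeleton theorem: concludes the crux BY
NAME from the registered stubs (S1a/S1b imported and proved; the only sorries of the file sit inside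
S2, S3, S4a, S5, S6 — plus the stand-in copy of the landed S4b). -/
theorem NestingRigidity_of : NestingRigidity :=
  nestingRigidity_of_stubs stub_cloudAdmissibility stub_cloudEnergy stub_towerPressureFamily
    stub_chargeQuantisation (towerLaw_of stub_towerTilt stub_tiltUniqueness) stub_fusion stub_transfer

end Summit.CriticalPhenomena.CardyFormulaZ2.Cruxes.NestingRigidity.RingCloudTomography

end
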